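import Mathlib

/-!
# T5SplittingTwist — [A-split] and [A-2] of route/T5-SUPPORT-p3.md §14(e) in kernel form
(cell pub-hodge-repro2, seat p3)

The prose (adopted by N3 v0.3 §N3.10) uses two one-line facts: **[A-split]** «two splittings of
the cover over U(V_v) × U(W_v) differ by a character ξ_V ⊠ ξ_W, so ω^{cell} = ω^{MVW} ⊗ (ξ_V ⊠ ξ_W),
and the Lemma for ω^{cell} is the Lemma for ω^{MVW} applied to (σ ⊗ ξ_V⁻¹, π ⊗ ξ_W⁻¹) —
cuspidality, irreducibility and the uniqueness conclusion are invariant under twisting by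
characters»; **[A-2]** «an irreducible cuspidal representation is not a quotient of a properly
induced representation: it would be a sub-representation, and Frobenius reciprocity
Hom(π, i τ) = Hom(r π, τ) gives r π ≠ 0». This file proves the group theory and linear algebra
behind both, on Mathlib's `Representation`, `Subrepresentation`, `IsIrreducible`,
`IsIntertwiningMap` and `Coinvariants.ker`, over an abstract commutative (semi)ring `k`:
1. two homomorphic sections of a central extension differ by a homomorphism into the (central)
   kernel (`sectionQuotientHom`, `apply_eq_sectionQuotientHom_mul`);
2. a character of `G₁ × G₂` is `ξ₁ ⊠ ξ₂` (`coprod_restrict` = Mathlib `MonoidHom.coprod_unique`);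
3. `twist ρ χ` (g ↦ χ g • ρ g): subrepresentations (`subrepresentationOrderIso`), irreducibility
   (`isIrreducible_twist_iff`) and intertwining maps (`isIntertwiningMap_twist_iff`) are the same
   for `ρ` and `twist ρ χ`; the pull-back of `ω` along `s₁` is the twist of its pull-back along
   `s₂` when `ker p` acts by scalars (`comp_section_eq_twist`), whence the transport
   `isIntertwiningMap_comp_section_iff`; `twist_extTprod`: twist (σ ⊠ π) (ξ₁ ⊠ ξ₂) = twist σ ξ₁ ⊠ twist π ξ₂;
4. a twist trivial on `N` leaves the `N`-coinvariants unchanged (`coinvariantsKer_twist_of_le_ker`),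
   and every character is trivial on `N ≤ [G, G]` (`coinvariantsKer_twist_of_le_commutator`);
5. [A-2]: Frobenius reciprocity (a hypothesis) and `r π = 0` force `Hom(π, i τ) = 0`
   (`hom_eq_zero_of_jacquet_subsingleton`, `not_injective_of_jacquet_subsingleton`).
Honest scope: nothing about the metaplectic cover, the Weil representation, U(V_v), U(W_v),
parabolic subgroups or Jacquet functors is formalised. Mathlib only; standard axioms.
-/

namespace Summit.Ventures.HodgeRepro2.T5SplittingTwist

/-! ## 1. Sections of a central extension -/

section CentralExtension
variable {Gt G : Type*} [Group Gt] [Group G]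

/-- The pointwise quotient `g ↦ s₁ g * (s₂ g)⁻¹` of two sections. -/
def sectionQuotient (s₁ s₂ : G →* Gt) (g : G) : Gt :=
  s₁ g * (s₂ g)⁻¹

/-- `s₁ g = (s₁ g * (s₂ g)⁻¹) * s₂ g`. -/
theorem apply_eq_sectionQuotient_mul (s₁ s₂ : G →* Gt) (g : G) :
    s₁ g = sectionQuotient s₁ s₂ g * s₂ g := by
  simp [sectionQuotient]

/-- If both `s₁`, `s₂` are sections of `p`, their quotient lies in `ker p`. -/
theorem sectionQuotient_mem_ker (p : Gt →* G) (s₁ s₂ : G →* Gt)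
    (h₁ : ∀ g, p (s₁ g) = g) (h₂ : ∀ g, p (s₂ g) = g) (g : G) :
    sectionQuotient s₁ s₂ g ∈ p.ker := by
  rw [MonoidHom.mem_ker, sectionQuotient, map_mul, map_inv, h₁, h₂, mul_inv_cancel]

/-- For a central extension (`ker p ≤ Z(Gt)`) the quotient of two sections is central. -/
theorem sectionQuotient_mem_center (p : Gt →* G) (s₁ s₂ : G →* Gt)
    (h₁ : ∀ g, p (s₁ g) = g) (h₂ : ∀ g, p (s₂ g) = g) (hc : p.ker ≤ Subgroup.center Gt)
    (g : G) : sectionQuotient s₁ s₂ g ∈ Subgroup.center Gt :=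
  hc (sectionQuotient_mem_ker p s₁ s₂ h₁ h₂ g)

/-- The quotient of two sections of a central extension is multiplicative. -/
theorem sectionQuotient_mul (p : Gt →* G) (s₁ s₂ : G →* Gt)
    (h₁ : ∀ g, p (s₁ g) = g) (h₂ : ∀ g, p (s₂ g) = g) (hc : p.ker ≤ Subgroup.center Gt)
    (g h : G) :
    sectionQuotient s₁ s₂ (g * h) = sectionQuotient s₁ s₂ g * sectionQuotient s₁ s₂ h := by
  have hz : ∀ x : Gt, x * sectionQuotient s₁ s₂ h = sectionQuotient s₁ s₂ h * x := fun x =>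
    (Subgroup.mem_center_iff.mp (sectionQuotient_mem_center p s₁ s₂ h₁ h₂ hc h)) x
  calc sectionQuotient s₁ s₂ (g * h)
      = s₁ g * (s₁ h * (s₂ h)⁻¹) * (s₂ g)⁻¹ := by
        simp [sectionQuotient, map_mul, mul_assoc]
    _ = s₁ g * sectionQuotient s₁ s₂ h * (s₂ g)⁻¹ := rfl
    _ = sectionQuotient s₁ s₂ h * s₁ g * (s₂ g)⁻¹ := by rw [hz (s₁ g)]
    _ = sectionQuotient s₁ s₂ h * sectionQuotient s₁ s₂ g := by
        simp [sectionQuotient, mul_assoc]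
    _ = sectionQuotient s₁ s₂ g * sectionQuotient s₁ s₂ h := (hz _).symm

/-- The quotient of two sections of a central extension, as a homomorphism `G →* ker p`
(the «character» by which the two splittings differ). -/
def sectionQuotientHom (p : Gt →* G) (s₁ s₂ : G →* Gt)
    (h₁ : ∀ g, p (s₁ g) = g) (h₂ : ∀ g, p (s₂ g) = g) (hc : p.ker ≤ Subgroup.center Gt) :
    G →* p.ker where
  toFun g := ⟨sectionQuotient s₁ s₂ g, sectionQuotient_mem_ker p s₁ s₂ h₁ h₂ g⟩
  map_one' := by
    ext
    simp [sectionQuotient]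
  map_mul' g h := by
    ext
    exact sectionQuotient_mul p s₁ s₂ h₁ h₂ hc g h

/-- The underlying element of `sectionQuotientHom … g` is `s₁ g * (s₂ g)⁻¹`. -/
theorem sectionQuotientHom_apply_coe (p : Gt →* G) (s₁ s₂ : G →* Gt)
    (h₁ : ∀ g, p (s₁ g) = g) (h₂ : ∀ g, p (s₂ g) = g) (hc : p.ker ≤ Subgroup.center Gt)
    (g : G) : ((sectionQuotientHom p s₁ s₂ h₁ h₂ hc g : p.ker) : Gt) = s₁ g * (s₂ g)⁻¹ := rfl

/-- `s₁ = ξ · s₂` with `ξ = sectionQuotientHom …`. -/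
theorem apply_eq_sectionQuotientHom_mul (p : Gt →* G) (s₁ s₂ : G →* Gt)
    (h₁ : ∀ g, p (s₁ g) = g) (h₂ : ∀ g, p (s₂ g) = g) (hc : p.ker ≤ Subgroup.center Gt)
    (g : G) : s₁ g = (sectionQuotientHom p s₁ s₂ h₁ h₂ hc g : Gt) * s₂ g :=
  apply_eq_sectionQuotient_mul s₁ s₂ g

/-- Two sections with quotient `1` coincide. -/
theorem eq_of_sectionQuotient_eq_one (s₁ s₂ : G →* Gt)
    (h : ∀ g, sectionQuotient s₁ s₂ g = 1) : s₁ = s₂ := by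
  ext g
  have := h g
  rwa [sectionQuotient, mul_inv_eq_one] at this

end CentralExtension

/-! ## 2. Characters of a product group -/

section ProductCharacter
variable {G₁ G₂ A : Type*} [Group G₁] [Group G₂] [CommGroup A]

/-- A homomorphism from `G₁ × G₂` into a commutative group is `ξ₁ ⊠ ξ₂` with
`ξ₁ = ξ ∘ inl`, `ξ₂ = ξ ∘ inr` (Mathlib `MonoidHom.coprod_unique`). -/
theorem coprod_restrict (ξ : G₁ × G₂ →* A) :
    (ξ.comp (MonoidHom.inl G₁ G₂)).coprod (ξ.comp (MonoidHom.inr G₁ G₂)) = ξ :=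
  MonoidHom.coprod_unique ξ

end ProductCharacter

/-! ## 3. Twisting a representation by a character -/

section Twist

variable {k G V : Type*} [CommSemiring k] [Monoid G] [AddCommMonoid V] [Module k V]

/-- The twist `g ↦ χ g • ρ g` of a representation by a character `χ : G →* kˣ`. -/
def twist (ρ : Representation k G V) (χ : G →* kˣ) : Representation k G V where
  toFun g := (χ g : k) • ρ g
  map_one' := by simp
  map_mul' g h := by
    simp only [map_mul, Units.val_mul]
    rw [mul_smul, smul_mul_assoc, mul_smul_comm]

/-- `twist ρ χ g = χ g • ρ g`. -/
@[simp]
theorem twist_apply (ρ : Representation k G V) (χ : G →* kˣ) (g : G) :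
    twist ρ χ g = (χ g : k) • ρ g := rfl

/-- `twist ρ χ g v = χ g • ρ g v`. -/
theorem twist_apply_apply (ρ : Representation k G V) (χ : G →* kˣ) (g : G) (v : V) :
    twist ρ χ g v = (χ g : k) • ρ g v := rfl

/-- The twist by the trivial character is `ρ`. -/
@[simp]
theorem twist_one (ρ : Representation k G V) : twist ρ 1 = ρ := by
  ext g v
  simp

/-- Two twists compose to the twist by the product character. -/
theorem twist_twist (ρ : Representation k G V) (χ χ' : G →* kˣ) :
    twist (twist ρ χ) χ' = twist ρ (χ * χ') := by
  ext g v
  simp only [twist_apply_apply, MonoidHom.mul_apply, Units.val_mul, mul_smul]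
  exact smul_comm _ _ _

/-- Twisting by `χ` and then by `χ⁻¹` gives back `ρ`. -/
theorem twist_inv_twist (ρ : Representation k G V) (χ : G →* kˣ) :
    twist (twist ρ χ) χ⁻¹ = ρ := by
  ext g v
  simp only [twist_apply_apply, MonoidHom.inv_apply, smul_smul, Units.inv_mul, one_smul]

/-- Twisting by `χ⁻¹` and then by `χ` gives back `ρ`. -/
theorem twist_twist_inv (ρ : Representation k G V) (χ : G →* kˣ) :
    twist (twist ρ χ⁻¹) χ = ρ := by
  ext g v
  simp only [twist_apply_apply, MonoidHom.inv_apply, smul_smul, Units.mul_inv, one_smul]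

/-- Pull-back of a twist along a homomorphism is the twist of the pull-back. -/
theorem comp_twist {H : Type*} [Monoid H] (ρ : Representation k G V) (χ : G →* kˣ)
    (f : H →* G) : (twist ρ χ).comp f = twist (ρ.comp f) (χ.comp f) := by
  ext h v
  simp

/-- A twist by a character trivial on the image of `f` is invisible after pull-back. -/
theorem comp_twist_of_comp_eq_one {H : Type*} [Monoid H] (ρ : Representation k G V)
    (χ : G →* kˣ) (f : H →* G) (hf : χ.comp f = 1) : (twist ρ χ).comp f = ρ.comp f := by
  rw [comp_twist, hf, twist_one]

/-- Membership in a submodule is unchanged by a unit scalar. -/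
theorem unit_smul_mem_iff (W : Submodule k V) (u : kˣ) (v : V) :
    (u : k) • v ∈ W ↔ v ∈ W := by
  constructor
  · intro h
    have := W.smul_mem ((u⁻¹ : kˣ) : k) h
    rwa [smul_smul, Units.inv_mul, one_smul] at this
  · intro h
    exact W.smul_mem _ h

/-- The subrepresentations of `twist ρ χ` are those of `ρ` (same submodules), as an order
isomorphism. -/
def subrepresentationOrderIso (ρ : Representation k G V) (χ : G →* kˣ) :
    Subrepresentation (twist ρ χ) ≃o Subrepresentation ρ where
  toFun W :=
    ⟨W.toSubmodule, fun g v hv =>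
      (unit_smul_mem_iff W.toSubmodule (χ g) (ρ g v)).mp (W.apply_mem_toSubmodule g hv)⟩
  invFun W :=
    ⟨W.toSubmodule, fun g v hv =>
      (unit_smul_mem_iff W.toSubmodule (χ g) (ρ g v)).mpr (W.apply_mem_toSubmodule g hv)⟩
  left_inv _ := rfl
  right_inv _ := rfl
  map_rel_iff' := Iff.rfl

/-- Intertwining maps between `twist ρ₁ χ` and `twist ρ₂ χ` are exactly those between `ρ₁`
and `ρ₂` (Mathlib `Representation.IsIntertwiningMap`). -/
theorem isIntertwiningMap_twist_iff {V₂ : Type*} [AddCommMonoid V₂] [Module k V₂]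
    (ρ₁ : Representation k G V) (ρ₂ : Representation k G V₂) (χ : G →* kˣ)
    (f : V →ₗ[k] V₂) :
    Representation.IsIntertwiningMap (twist ρ₁ χ) (twist ρ₂ χ) f ↔
      Representation.IsIntertwiningMap ρ₁ ρ₂ f := by
  simp only [Representation.isIntertwiningMap_iff, twist_apply_apply, map_smul]
  constructor
  · intro h g v
    have := h g v
    rwa [← Units.smul_def, ← Units.smul_def, smul_left_cancel_iff] at this
  · intro h g v
    rw [h g v]

end Twist

section Irreducible

variable {k G V : Type*} [Field k] [Monoid G] [AddCommGroup V] [Module k V]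

/-- Irreducibility (Mathlib `Representation.IsIrreducible`) is unchanged by a twist. -/
theorem isIrreducible_twist_iff (ρ : Representation k G V) (χ : G →* kˣ) :
    Representation.IsIrreducible (twist ρ χ) ↔ Representation.IsIrreducible ρ :=
  (subrepresentationOrderIso ρ χ).isSimpleOrder_iff

end Irreducible

/-! ## 3b. Pull-backs along two sections of a central extension -/

section PullBack

variable {k Gt G V : Type*} [CommSemiring k] [Group Gt] [Group G] [AddCommMonoid V]
  [Module k V]

/-- If `ker p` acts on `ω` through scalars `χ₀`, the pull-back of `ω` along `s₁` is the twist of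
its pull-back along `s₂` by `χ₀ ∘ ξ`, `ξ` = the quotient of the two sections. -/
theorem comp_section_eq_twist (ω : Representation k Gt V) (p : Gt →* G) (s₁ s₂ : G →* Gt)
    (h₁ : ∀ g, p (s₁ g) = g) (h₂ : ∀ g, p (s₂ g) = g) (hc : p.ker ≤ Subgroup.center Gt)
    (χ₀ : p.ker →* kˣ) (hχ₀ : ∀ z : p.ker, ω z = (χ₀ z : k) • LinearMap.id) :
    ω.comp s₁ = twist (ω.comp s₂) (χ₀.comp (sectionQuotientHom p s₁ s₂ h₁ h₂ hc)) := by
  ext g v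
  simp only [MonoidHom.coe_comp, Function.comp_apply, twist_apply_apply]
  rw [apply_eq_sectionQuotientHom_mul p s₁ s₂ h₁ h₂ hc g, map_mul, Module.End.mul_apply, hχ₀]
  simp

/-- The transport of intertwiners: `Hom(ω ∘ s₁, τ) = Hom(ω ∘ s₂, twist τ (χ₀ ∘ ξ)⁻¹)`. -/
theorem isIntertwiningMap_comp_section_iff {V₂ : Type*} [AddCommMonoid V₂] [Module k V₂]
    (ω : Representation k Gt V) (p : Gt →* G) (s₁ s₂ : G →* Gt)
    (h₁ : ∀ g, p (s₁ g) = g) (h₂ : ∀ g, p (s₂ g) = g) (hc : p.ker ≤ Subgroup.center Gt)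
    (χ₀ : p.ker →* kˣ) (hχ₀ : ∀ z : p.ker, ω z = (χ₀ z : k) • LinearMap.id)
    (τ : Representation k G V₂) (f : V →ₗ[k] V₂) :
    Representation.IsIntertwiningMap (ω.comp s₁) τ f ↔
      Representation.IsIntertwiningMap (ω.comp s₂)
        (twist τ (χ₀.comp (sectionQuotientHom p s₁ s₂ h₁ h₂ hc))⁻¹) f := by
  rw [comp_section_eq_twist ω p s₁ s₂ h₁ h₂ hc χ₀ hχ₀]
  set ξ := χ₀.comp (sectionQuotientHom p s₁ s₂ h₁ h₂ hc)
  conv_lhs => rw [← twist_twist_inv τ ξ]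
  exact isIntertwiningMap_twist_iff _ _ ξ f

/-- Non-vanishing of the intertwining space is transported across the two splittings. -/
theorem exists_intertwiningMap_comp_section_iff {V₂ : Type*} [AddCommMonoid V₂] [Module k V₂]
    (ω : Representation k Gt V) (p : Gt →* G) (s₁ s₂ : G →* Gt)
    (h₁ : ∀ g, p (s₁ g) = g) (h₂ : ∀ g, p (s₂ g) = g) (hc : p.ker ≤ Subgroup.center Gt)
    (χ₀ : p.ker →* kˣ) (hχ₀ : ∀ z : p.ker, ω z = (χ₀ z : k) • LinearMap.id)
    (τ : Representation k G V₂) :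
    (∃ f : V →ₗ[k] V₂, f ≠ 0 ∧ Representation.IsIntertwiningMap (ω.comp s₁) τ f) ↔
      ∃ f : V →ₗ[k] V₂, f ≠ 0 ∧ Representation.IsIntertwiningMap (ω.comp s₂)
        (twist τ (χ₀.comp (sectionQuotientHom p s₁ s₂ h₁ h₂ hc))⁻¹) f := by
  simp only [isIntertwiningMap_comp_section_iff ω p s₁ s₂ h₁ h₂ hc χ₀ hχ₀ τ]

end PullBack

/-! ## 3c. External tensor products -/

section Tensor

open TensorProduct

variable {k G₁ G₂ V₁ V₂ : Type*} [CommSemiring k] [Monoid G₁] [Monoid G₂]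
  [AddCommMonoid V₁] [Module k V₁] [AddCommMonoid V₂] [Module k V₂]

/-- The external tensor product `σ ⊠ π` of representations of `G₁` and `G₂`, as a representation
of `G₁ × G₂` on `V₁ ⊗ V₂` (Mathlib `Representation.tprod` of the two pull-backs). -/
noncomputable def extTprod (σ : Representation k G₁ V₁) (π : Representation k G₂ V₂) :
    Representation k (G₁ × G₂) (V₁ ⊗[k] V₂) :=
  Representation.tprod (σ.comp (MonoidHom.fst G₁ G₂)) (π.comp (MonoidHom.snd G₁ G₂))

/-- `(σ ⊠ π) (g₁, g₂) = σ g₁ ⊗ π g₂`. -/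
theorem extTprod_apply (σ : Representation k G₁ V₁) (π : Representation k G₂ V₂)
    (g : G₁ × G₂) : extTprod σ π g = TensorProduct.map (σ g.1) (π g.2) := rfl

/-- `twist (σ ⊠ π) (ξ₁ ⊠ ξ₂) = twist σ ξ₁ ⊠ twist π ξ₂`. -/
theorem twist_extTprod (σ : Representation k G₁ V₁) (π : Representation k G₂ V₂)
    (ξ₁ : G₁ →* kˣ) (ξ₂ : G₂ →* kˣ) :
    twist (extTprod σ π) (ξ₁.coprod ξ₂) = extTprod (twist σ ξ₁) (twist π ξ₂) := by
  ext g
  simp only [twist_apply, extTprod_apply, MonoidHom.coprod_apply, Units.val_mul]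
  rw [TensorProduct.map_smul_left, TensorProduct.map_smul_right, smul_smul]

/-- Any character of `G₁ × G₂` is `ξ₁ ⊠ ξ₂`, so the previous lemma applies to it. -/
theorem twist_extTprod_of_character (σ : Representation k G₁ V₁) (π : Representation k G₂ V₂)
    (ξ : G₁ × G₂ →* kˣ) :
    twist (extTprod σ π) ξ =
      extTprod (twist σ (ξ.comp (MonoidHom.inl G₁ G₂)))
        (twist π (ξ.comp (MonoidHom.inr G₁ G₂))) := by
  rw [← twist_extTprod, MonoidHom.coprod_unique]

end Tensor

/-! ## 4. Coinvariants and twists trivial on a subgroup -/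

section Coinvariants

variable {k G V : Type*} [CommRing k] [Group G] [AddCommGroup V] [Module k V]

/-- A character trivial on `N` restricts to `1` on `N`. -/
theorem comp_subtype_eq_one_of_le_ker (χ : G →* kˣ) (N : Subgroup G) (hN : N ≤ χ.ker) :
    χ.comp N.subtype = 1 :=
  MonoidHom.ext fun n => MonoidHom.mem_ker.mp (hN n.2)

/-- Restricted to a subgroup on which `χ` is trivial, the twist is invisible. -/
theorem comp_subtype_twist_of_le_ker (ρ : Representation k G V) (χ : G →* kˣ)
    (N : Subgroup G) (hN : N ≤ χ.ker) :
    (twist ρ χ).comp N.subtype = ρ.comp N.subtype :=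
  comp_twist_of_comp_eq_one ρ χ N.subtype (comp_subtype_eq_one_of_le_ker χ N hN)

/-- A twist by a character trivial on `N` does not change the `N`-coinvariants (Mathlib
`Representation.Coinvariants.ker` of the restriction to `N`). -/
theorem coinvariantsKer_twist_of_le_ker (ρ : Representation k G V) (χ : G →* kˣ)
    (N : Subgroup G) (hN : N ≤ χ.ker) :
    Representation.Coinvariants.ker ((twist ρ χ).comp N.subtype) =
      Representation.Coinvariants.ker (ρ.comp N.subtype) := by
  rw [comp_subtype_twist_of_le_ker ρ χ N hN]

/-- Every character (a homomorphism into the commutative group `kˣ`) is trivial on the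
commutator subgroup. -/
theorem commutator_le_ker (χ : G →* kˣ) : commutator G ≤ χ.ker :=
  Abelianization.commutator_subset_ker χ

/-- Hence a twist changes no `N`-coinvariants for `N ≤ [G, G]` (e.g. a unipotent radical
contained in the commutator subgroup). -/
theorem coinvariantsKer_twist_of_le_commutator (ρ : Representation k G V) (χ : G →* kˣ)
    (N : Subgroup G) (hN : N ≤ commutator G) :
    Representation.Coinvariants.ker ((twist ρ χ).comp N.subtype) =
      Representation.Coinvariants.ker (ρ.comp N.subtype) :=
  coinvariantsKer_twist_of_le_ker ρ χ N (hN.trans (commutator_le_ker χ))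

/-- «The Jacquet module vanishes» (`V_N = 0`, i.e. the kernel is everything) is unchanged by
such a twist. -/
theorem coinvariantsKer_eq_top_twist_iff (ρ : Representation k G V) (χ : G →* kˣ)
    (N : Subgroup G) (hN : N ≤ χ.ker) :
    Representation.Coinvariants.ker ((twist ρ χ).comp N.subtype) = ⊤ ↔
      Representation.Coinvariants.ker (ρ.comp N.subtype) = ⊤ := by
  rw [coinvariantsKer_twist_of_le_ker ρ χ N hN]

end Coinvariants

/-! ## 5. [A-2]: Frobenius reciprocity and a vanishing Jacquet module -/

section Frobenius

variable {k π iτ rπ τ : Type*} [CommSemiring k] [AddCommMonoid π] [Module k π]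
  [AddCommMonoid iτ] [Module k iτ] [AddCommMonoid rπ] [Module k rπ]
  [AddCommMonoid τ] [Module k τ]

/-- Every linear map out of a zero module is zero. -/
theorem linearMap_eq_zero_of_subsingleton [Subsingleton rπ] (φ : rπ →ₗ[k] τ) : φ = 0 := by
  ext x
  rw [Subsingleton.elim x 0, map_zero]
  rfl

/-- Frobenius reciprocity `Hom(π, i τ) ≃ Hom(r π, τ)` (a hypothesis here) and `r π = 0` force
`Hom(π, i τ) = 0`. -/
theorem hom_eq_zero_of_jacquet_subsingleton [Subsingleton rπ]
    (e : (π →ₗ[k] iτ) ≃ (rπ →ₗ[k] τ)) (he : e 0 = 0) (f : π →ₗ[k] iτ) : f = 0 := by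
  apply e.injective
  rw [he]
  exact linearMap_eq_zero_of_subsingleton (e f)

/-- Consequently no non-zero module `π` with `r π = 0` embeds into `i τ`. -/
theorem not_injective_of_jacquet_subsingleton [Subsingleton rπ] [Nontrivial π]
    (e : (π →ₗ[k] iτ) ≃ (rπ →ₗ[k] τ)) (he : e 0 = 0) (f : π →ₗ[k] iτ) :
    ¬ Function.Injective f := by
  intro hf
  have h0 : f = 0 := hom_eq_zero_of_jacquet_subsingleton e he f
  obtain ⟨x, hx⟩ := exists_ne (0 : π)
  apply hx
  apply hf
  rw [h0]
  rfl

end Frobenius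

end Summit.Ventures.HodgeRepro2.T5SplittingTwist
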